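/-
Copyright (c) 2026. All rights reserved.
Released under Apache 2.0 license as described in the file LICENSE.
Authors: abc-iut cell, seat abc-iut-w6-d109 (gen 2).
-/
import Literature.GroupTheory.TwistedCommutatorWidthSeries
import Literature.GroupTheory.LowerPowerCentralSeriesFinite
import Literature.GroupTheory.ProPPowerMap

/-!
# Twisted commutator width in profinite groups: `⁅P′, U⁆ · P′^q` is closed

Let `G` be a profinite group (compact, totally disconnected topological group), `U ≤ G` a subgroup
topologically generated by the entries `g₁, …, g_r` of a list `l`, and `P′ ⊴ G` a normal subgroup with
`P′ ≤ U`, all of whose elements are pro-`p`-convergent (`x ^ p ^ k → 1`), topologically generated by the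
`U`-conjugates of the entries `x₁, …, x_s ∈ P′` of a list `m`.  Let `q` be a multiple of `p`.

* `commutator_sup_powClosure_eq_wordSet_of_proP` — the ABSTRACT subgroup
  `⁅P′, U⁆ ⊔ ⟨{y ^ q | y ∈ P′}⟩` EQUALS the set `{⁅g₁,u₁⁆⋯⁅g_r,u_r⁆ · ⁅x₁,z₁⁆⋯⁅x_s,z_s⁆ · y^q | uᵢ, zₖ, y ∈ P′}`
  (twisted commutator width `r + s + 1`);
* `isCompact_commutator_sup_powClosure_of_proP`, `isClosed_commutator_sup_powClosure_of_proP` —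
  hence, when `P′` is closed, it is compact and CLOSED.

Proof: in each finite quotient `G ⧸ N` (`N` open normal) the image of `P′` is a finite `p`-group, whose
lower `q`-central series terminates (`exists_lowerPowSeries_eq_bot`), so the abstract width theorem
`commutator_sup_powClosure_eq_wordSet` applies there; hence the subgroup lies in `W · N` for every `N`,
and `⋂_N W · N = W` because `W` is compact (`mem_of_forall_mem_mul_openNormalSubgroup`).  This is the
relative ("twisted") form of J. D. Dixon, M. du Sautoy, A. Mann, D. Segal, *Analytic pro-`p` groups*,
Prop. 1.19; it removes any finite-generation hypothesis on `P′` ITSELF (only finite NORMAL generation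
over a topologically finitely generated `U` is used), which is what the wild inertia of a `p`-adic field
requires.  Consumers: `StronglyCompleteProPNormalGen.lean` (hypothesis (c″) of
`isOpen_of_finiteIndex_of_proP_normal`, strong completeness).

[cite: DDMSAnalyticProP1999, Prop 1.19, Thm 1.17]
-/

namespace Literature.GroupTheory

open scoped Pointwise commutatorElement

section Compact

variable {G : Type*} [Group G] [TopologicalSpace G] [IsTopologicalGroup G]

/-- `T(l, K)` is compact for `K` compact (a product of continuous images of `K`).
[cite: DDMSAnalyticProP1999, Prop 1.19 (proof)] -/
theorem isCompact_wordSet (l : List G) {K : Set G} (hK : IsCompact K) :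
    IsCompact (l.map fun a => (fun y : G => ⁅a, y⁆) '' K).prod := by
  induction l with
  | nil => rw [List.map_nil, List.prod_nil, ← Set.singleton_one]; exact isCompact_singleton
  | cons a l ih =>
    rw [List.map_cons, List.prod_cons]
    refine IsCompact.mul ?_ ih
    have hc : Continuous fun y : G => ⁅a, y⁆ := by
      simp only [commutatorElement_def]; fun_prop
    exact hK.image hc

/-- The word set `T(l, K) · T(m, K) · {y ^ q | y ∈ K}` is compact for `K` compact.
[cite: DDMSAnalyticProP1999, Prop 1.19 (proof)] -/
theorem isCompact_wordSet_mul (l m : List G) (q : ℕ) {K : Set G} (hK : IsCompact K) :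
    IsCompact ((l.map fun a => (fun y : G => ⁅a, y⁆) '' K).prod *
      (m.map fun a => (fun y : G => ⁅a, y⁆) '' K).prod * ((fun y : G => y ^ q) '' K)) :=
  ((isCompact_wordSet l hK).mul (isCompact_wordSet m hK)).mul (hK.image (continuous_pow q))

end Compact

section Profinite

variable {G : Type*} [Group G] [TopologicalSpace G] [IsTopologicalGroup G] [CompactSpace G]
  [TotallyDisconnectedSpace G]

omit [CompactSpace G] [TotallyDisconnectedSpace G] in
/-- A point of the closure of a subgroup `H` maps into the image of `H` in `G ⧸ N` for `N` open
normal (`closure H ⊆ H · N`). [cite: DDMSAnalyticProP1999, §1.2] -/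
theorem mk_mem_map_of_mem_closure (H : Subgroup G) (N : OpenNormalSubgroup G) {x : G}
    (hx : x ∈ closure (H : Set G)) :
    (QuotientGroup.mk' (N : Subgroup G)) x ∈ H.map (QuotientGroup.mk' (N : Subgroup G)) := by
  have hopen : IsOpen ((H ⊔ (N : Subgroup G) : Subgroup G) : Set G) :=
    Subgroup.isOpen_mono le_sup_right N.isOpen
  have hcl : IsClosed ((H ⊔ (N : Subgroup G) : Subgroup G) : Set G) :=
    Subgroup.isClosed_of_isOpen _ hopen
  have hx' : x ∈ H ⊔ (N : Subgroup G) :=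
    (hcl.closure_subset_iff.mpr (SetLike.coe_subset_coe.mpr le_sup_left)) hx
  obtain ⟨h, hh, n, hn, rfl⟩ := Subgroup.mem_sup_of_normal_right.mp hx'
  refine ⟨h, hh, ?_⟩
  rw [QuotientGroup.mk'_apply, QuotientGroup.mk'_apply, QuotientGroup.mk_mul,
    (QuotientGroup.eq_one_iff n).mpr hn, mul_one]

/-- **Twisted commutator width in a profinite group.** Let `U ≤ G` be topologically generated by
the entries of `l` (which lie in `U`), `P′ ⊴ G` with `P′ ≤ U` be topologically generated by the
`U`-conjugates of the entries of `m` (which lie in `P′`), every element of `P′` pro-`p`-convergent,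
and `p ∣ q`.  Then the abstract subgroup `⁅P′, U⁆ ⊔ ⟨{y ^ q | y ∈ P′}⟩` equals
`T(l, P′) · T(m, P′) · {y ^ q | y ∈ P′}`. [cite: DDMSAnalyticProP1999, Prop 1.19] -/
theorem commutator_sup_powClosure_eq_wordSet_of_proP {p : ℕ} [hp : Fact p.Prime]
    (U : Subgroup G) (l : List G) (hlU : ∀ a ∈ l, a ∈ U)
    (hl : (U : Set G) ⊆ closure ((Subgroup.closure {a : G | a ∈ l} : Subgroup G) : Set G))
    (P' : Subgroup G) [hP'n : P'.Normal] (hP'c : IsClosed (P' : Set G)) (hP'U : P' ≤ U)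
    (m : List G) (hm : ∀ a ∈ m, a ∈ P')
    (hgen : (P' : Set G) ⊆
      closure ((Subgroup.closure {z : G | ∃ u ∈ U, ∃ a ∈ m, z = u * a * u⁻¹} : Subgroup G) : Set G))
    (hproP : ∀ x ∈ P', ∀ O ∈ nhds (1 : G), ∃ k : ℕ, x ^ p ^ k ∈ O) {q : ℕ} (hpq : p ∣ q) :
    ((⁅P', U⁆ ⊔ Subgroup.closure ((fun y : G => y ^ q) '' (P' : Set G)) : Subgroup G) : Set G) =
      (l.map fun a => (fun y : G => ⁅a, y⁆) '' (P' : Set G)).prod *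
        (m.map fun a => (fun y : G => ⁅a, y⁆) '' (P' : Set G)).prod *
        ((fun y : G => y ^ q) '' (P' : Set G)) := by
  classical
  refine Set.Subset.antisymm ?_ ?_
  swap
  · rintro _ ⟨_, ⟨t₁, ht₁, t₂, ht₂, rfl⟩, _, ⟨y, hy, rfl⟩, rfl⟩
    refine Subgroup.mul_mem _ (Subgroup.mul_mem _ ?_ ?_) ?_
    · refine Subgroup.mem_sup_left ?_
      rw [Subgroup.commutator_comm]
      exact wordSet_subset_commutator l U P' hlU ht₁
    · refine Subgroup.mem_sup_left (Subgroup.commutator_mono le_rfl hP'U ?_)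
      exact wordSet_subset_commutator m P' P' hm ht₂
    · exact Subgroup.mem_sup_right (Subgroup.subset_closure ⟨y, hy, rfl⟩)
  intro g hg
  have hWc := isCompact_wordSet_mul l m q hP'c.isCompact
  refine mem_of_forall_mem_mul_openNormalSubgroup hWc.isClosed fun N => ?_
  -- pass to the finite quotient `G ⧸ N`
  obtain ⟨π, hπ⟩ : ∃ π : G →* G ⧸ (N : Subgroup G), π = QuotientGroup.mk' (N : Subgroup G) :=
    ⟨_, rfl⟩
  have hπs : Function.Surjective π := hπ ▸ QuotientGroup.mk'_surjective _
  have hπ1 : ∀ x : G, π x = 1 ↔ x ∈ (N : Subgroup G) := fun x => by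
    rw [hπ, QuotientGroup.mk'_apply, QuotientGroup.eq_one_iff]
  haveI : Finite (G ⧸ (N : Subgroup G)) := Subgroup.quotient_finite_of_isOpen (N : Subgroup G) N.isOpen
  obtain ⟨Qb, hQb⟩ : ∃ Qb : Subgroup (G ⧸ (N : Subgroup G)), Qb = P'.map π := ⟨_, rfl⟩
  haveI hQbn : Qb.Normal := hQb ▸ hP'n.map π hπs
  -- the image of `P'` is a finite `p`-group
  have hQbp : IsPGroup p Qb := by
    rintro ⟨y, hy⟩
    rw [hQb] at hy
    obtain ⟨x, hx, rfl⟩ := hy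
    obtain ⟨k, hk⟩ := hproP x hx (N : Set G) (N.isOpen.mem_nhds N.one_mem)
    refine ⟨k, Subtype.ext ?_⟩
    rw [Subgroup.coe_pow, Subgroup.coe_one, ← map_pow, hπ1]
    exact hk
  -- hypotheses of the abstract width theorem, in `G ⧸ N`
  have hlb : ∀ u ∈ U.map π, u ∈ Subgroup.closure {b : G ⧸ (N : Subgroup G) | b ∈ l.map π} := by
    rintro _ ⟨u, hu, rfl⟩
    have h := mk_mem_map_of_mem_closure (Subgroup.closure {a : G | a ∈ l}) N (hl hu)
    rw [← hπ, MonoidHom.map_closure] at h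
    refine Subgroup.closure_mono ?_ h
    rintro _ ⟨a, ha, rfl⟩
    exact List.mem_map.mpr ⟨a, ha, rfl⟩
  have hlbU : ∀ b ∈ l.map π, b ∈ U.map π := by
    intro b hb
    obtain ⟨a, ha, rfl⟩ := List.mem_map.mp hb
    exact Subgroup.mem_map_of_mem π (hlU a ha)
  have hmb : ∀ b ∈ m.map π, b ∈ Qb := by
    intro b hb
    obtain ⟨a, ha, rfl⟩ := List.mem_map.mp hb
    rw [hQb]
    exact Subgroup.mem_map_of_mem π (hm a ha)
  have hQbU : Qb ≤ U.map π := hQb ▸ Subgroup.map_mono hP'U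
  have hgenb : ∀ x ∈ Qb, x ∈ Subgroup.closure
      {z : G ⧸ (N : Subgroup G) | ∃ u ∈ U.map π, ∃ b ∈ m.map π, z = u * b * u⁻¹} := by
    intro y hy
    rw [hQb] at hy
    obtain ⟨x, hx, rfl⟩ := hy
    have h := mk_mem_map_of_mem_closure
      (Subgroup.closure {z : G | ∃ u ∈ U, ∃ a ∈ m, z = u * a * u⁻¹}) N (hgen hx)
    rw [← hπ, MonoidHom.map_closure] at h
    refine Subgroup.closure_mono ?_ h
    rintro _ ⟨_, ⟨u, hu, a, ha, rfl⟩, rfl⟩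
    exact ⟨π u, Subgroup.mem_map_of_mem π hu, π a, List.mem_map.mpr ⟨a, ha, rfl⟩, by
      rw [map_mul, map_mul, map_inv]⟩
  -- the lower `q`-central series of `Qb` terminates
  obtain ⟨D, hD0, hDs⟩ : ∃ D : ℕ → Subgroup (G ⧸ (N : Subgroup G)), D 0 = Qb ∧
      ∀ j, D (j + 1) = ⁅D j, Qb⁆ ⊔
        Subgroup.closure ((fun y : G ⧸ (N : Subgroup G) => y ^ q) '' (D j : Set _)) := by
    refine ⟨fun j => (fun Dj : Subgroup (G ⧸ (N : Subgroup G)) => ⁅Dj, Qb⁆ ⊔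
        Subgroup.closure ((fun y : G ⧸ (N : Subgroup G) => y ^ q) '' (Dj : Set _)))^[j] Qb,
      Function.iterate_zero_apply _ _, fun j => ?_⟩
    exact Function.iterate_succ_apply' _ _ _
  obtain ⟨c, hc⟩ := exists_lowerPowSeries_eq_bot Qb hQbp hpq D hD0 hDs
  have hwidth := commutator_sup_powClosure_eq_wordSet Qb q D hD0 hDs (U.map π) (l.map π) (m.map π)
    hlbU hlb hmb hQbU hgenb hc
  -- `π g` lies in the image subgroup, which is the word set of the images
  have hπg : π g ∈ ((⁅Qb, U.map π⁆ ⊔ Subgroup.closure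
      ((fun y : G ⧸ (N : Subgroup G) => y ^ q) '' (Qb : Set _)) : Subgroup _) : Set _) := by
    have h := Subgroup.mem_map_of_mem π hg
    rw [Subgroup.map_sup, Subgroup.map_commutator, MonoidHom.map_closure] at h
    have hset : π '' ((fun y : G => y ^ q) '' (P' : Set G)) =
        (fun y : G ⧸ (N : Subgroup G) => y ^ q) '' (Qb : Set _) := by
      rw [hQb, Subgroup.coe_map, Set.image_image, Set.image_image]
      exact Set.image_congr fun y _ => map_pow π y q
    rw [hset, ← hQb] at h
    exact h
  rw [hwidth, hQb, Subgroup.coe_map, ← image_wordSet, ← image_wordSet] at hπg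
  have hset' : (fun y : G ⧸ (N : Subgroup G) => y ^ q) '' (π '' (P' : Set G)) =
      π '' ((fun y : G => y ^ q) '' (P' : Set G)) := by
    rw [Set.image_image, Set.image_image]
    exact Set.image_congr fun y _ => (map_pow π y q).symm
  rw [hset', ← Set.image_mul, ← Set.image_mul] at hπg
  obtain ⟨w, hw, hwg⟩ := hπg
  have hwg' : w⁻¹ * g ∈ (N : Subgroup G) := by
    rw [← hπ1, map_mul, map_inv, hwg, inv_mul_cancel]
  exact Set.mem_mul.mpr ⟨w, hw, w⁻¹ * g, hwg', mul_inv_cancel_left w g⟩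

/-- **`⁅P′, U⁆ · P′^q` is compact** under the hypotheses of
`commutator_sup_powClosure_eq_wordSet_of_proP`. [cite: DDMSAnalyticProP1999, Prop 1.19] -/
theorem isCompact_commutator_sup_powClosure_of_proP {p : ℕ} [hp : Fact p.Prime]
    (U : Subgroup G) (l : List G) (hlU : ∀ a ∈ l, a ∈ U)
    (hl : (U : Set G) ⊆ closure ((Subgroup.closure {a : G | a ∈ l} : Subgroup G) : Set G))
    (P' : Subgroup G) [hP'n : P'.Normal] (hP'c : IsClosed (P' : Set G)) (hP'U : P' ≤ U)
    (m : List G) (hm : ∀ a ∈ m, a ∈ P')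
    (hgen : (P' : Set G) ⊆
      closure ((Subgroup.closure {z : G | ∃ u ∈ U, ∃ a ∈ m, z = u * a * u⁻¹} : Subgroup G) : Set G))
    (hproP : ∀ x ∈ P', ∀ O ∈ nhds (1 : G), ∃ k : ℕ, x ^ p ^ k ∈ O) {q : ℕ} (hpq : p ∣ q) :
    IsCompact (((⁅P', U⁆ ⊔ Subgroup.closure ((fun y : G => y ^ q) '' (P' : Set G)) :
      Subgroup G) : Set G)) := by
  rw [commutator_sup_powClosure_eq_wordSet_of_proP U l hlU hl P' hP'c hP'U m hm hgen hproP hpq]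
  exact isCompact_wordSet_mul l m q hP'c.isCompact

/-- **`⁅P′, U⁆ · P′^q` is CLOSED** — the abstract subgroup generated by the twisted commutators
`⁅x, u⁆` (`x ∈ P′`, `u ∈ U`) and the `q`-th powers of `P′`, for `P′ ⊴ G` closed, pro-`p`,
topologically finitely normally generated over the topologically finitely generated `U ⊇ P′`, and
`p ∣ q`.  (No Nikolov–Segal-type input: relative Serre successive approximation.)
[cite: DDMSAnalyticProP1999, Prop 1.19] -/
theorem isClosed_commutator_sup_powClosure_of_proP {p : ℕ} [hp : Fact p.Prime]
    (U : Subgroup G) (l : List G) (hlU : ∀ a ∈ l, a ∈ U)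
    (hl : (U : Set G) ⊆ closure ((Subgroup.closure {a : G | a ∈ l} : Subgroup G) : Set G))
    (P' : Subgroup G) [hP'n : P'.Normal] (hP'c : IsClosed (P' : Set G)) (hP'U : P' ≤ U)
    (m : List G) (hm : ∀ a ∈ m, a ∈ P')
    (hgen : (P' : Set G) ⊆
      closure ((Subgroup.closure {z : G | ∃ u ∈ U, ∃ a ∈ m, z = u * a * u⁻¹} : Subgroup G) : Set G))
    (hproP : ∀ x ∈ P', ∀ O ∈ nhds (1 : G), ∃ k : ℕ, x ^ p ^ k ∈ O) {q : ℕ} (hpq : p ∣ q) :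
    IsClosed (((⁅P', U⁆ ⊔ Subgroup.closure ((fun y : G => y ^ q) '' (P' : Set G)) :
      Subgroup G) : Set G)) :=
  (isCompact_commutator_sup_powClosure_of_proP U l hlU hl P' hP'c hP'U m hm hgen hproP hpq).isClosed

end Profinite

end Literature.GroupTheory
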